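import Mathlib
import Summits.NavierStokesRegularity.OSWSelfSimilar.SheetNSLineTorusCascadeThresholdWiener
import Summits.NavierStokesRegularity.OSWSelfSimilar.SheetNSLineTorusCascadeThresholdDichotomy
import Summits.NavierStokesRegularity.OSWSelfSimilar.SheetNSLineTorusCascadeSynthesisLocal
import HarnessLib

/-!
# Viscous CLM on the torus (`a = 0`, `σ = 2`): THE CRITICAL AMPLITUDE IS NOT GLOBAL — at `c = κ*ν` every classical solution
# from `−c sin x` has `T ≤ log(κ*/8)/ν`; GLOBAL ⟺ `c < κ*ν` for EVERY `c ≥ 0`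

HONEST FRAMING (cell ns-blowup GROUP B «PROFILE SEARCH», zone Z3, row Z3-U addendum A-F2 of `HOME/profile/z3/CENSUS-Z3.md`;
human rulings D-0035/D-0074; Z3-TWIN lineage, eng-5 g15): **1-D MODEL (viscous Constantin–Lax–Majda equation
`ω_t = ω Hω + ν ω_xx` on `𝕋`, `H = hilbertTransformCircle`); real analysis on the Fourier cascade composed with eng-3's classical-solution
link, kernel-checked; not Euler, not Navier–Stokes; «violates: none — MODEL»; `κ*` is a constant of the MODEL.**

OBJECTS (from the tree): `IsClassicalSolution`, `coef` (`…LinkModes`), `coef_re_eq_cascadeSolution` / `exists_abs_coef_re_le_uniform`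
(`…ThresholdDichotomy`), `criticalConstant = κ*` (`…Threshold`), `lt_criticalConstant_of_partialSum_le` and the bootstrap
`partialSum_le_of_rhs_bound` (`…ThresholdWiener`), `IsNonnegCascade.partialSum_le_two_mul` (`…ThresholdOpen`). No definitions here.

THE ARGUMENT. g14's horizon theorem used only the TERMWISE bound `|c_k(t)| ≤ A` of a classical solution (⇒ non-strict `c/ν ≤ κ*`).
Here a classical solution on `[0, T]` is WIENER-bounded on every `[0, T′]`, `T′ < T` (`exists_partialSum_cascadeSolution_le`): on
`[0, 1/c]` by the size-free short-time Riccati bound; on `[1/c, T′]` because `d/dt c_k` is at once the cascade right-hand side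
(`hasDerivAt_coef`) and `−(i/π)·(ωt)^(k)` (`hasDerivAt_mode`) with `ωt` bounded on the COMPACT `[1/c, T′] × [0, 2π] ⊂ (0,T) × ℝ`, so
`|½ Σ_{i+j=k} c_i c_j − νk² c_k| ≤ Q` there (`exists_abs_rhs_le_interior`) and the two-step bootstrap gives `Σ_{k≤K} c_k ≤ 2C₂`. If
`T > log(c/(8ν))/ν`, pick `T′` in between: Wiener-bounded on `[0, νT′] ∋ log((c/ν)/8)`, so `c/ν < κ*` by the strict window lemma.

THEOREMS (`ν > 0`).
* `lt_critical_of_horizon_gt` — classical on `[0, T]` from `−c sin x` (`c ≥ 0`) with `T > log(c/(8ν))/ν` ⇒ `c < κ*ν`;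
  `horizon_le_of_critical_le` — `κ*ν ≤ c` ⇒ `T ≤ log(c/(8ν))/ν`; **`horizon_le_critical` — at `c = κ*ν`, `T ≤ log(κ*/8)/ν`**;
* **`not_global_critical`**, `not_global_of_critical_le` — NO global classical solution from `−κ*ν sin x` (or any `c ≥ κ*ν`);
  **`global_iff_lt_critical_all` — for every `c ≥ 0`: a global classical solution from `−c sin x` exists iff `c < κ*ν`**
  (g14's `global_iff_lt_critical` without `c ≠ κ*ν`); one-citation form `sine_datum_sharp_dichotomy`;
* **`exists_classicalSolution_of_partialSum_le` — WIENER CONTINUATION CRITERION** (converse): a Galerkin bound of the explicit sine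
  cascade on `[0, T₀]` gives a classical solution on `[0, T₀]` (openness ⇒ geometric window envelope ⇒ eng-3's
  `exists_classicalSolution_of_window_envelope`): the classical solution lives exactly as long as its Wiener norm stays bounded.

bears_on: LADDER-NS N5 / zone Z3 (row Z3-U, A-F2 (t1) datum-free tier, dichotomy form) → N1 linear core. WHAT THIS IS NOT: not NS; whether
`κ* ∈ thresholdSet` (termwise boundedness of `κ*^k E_k`) is NOT decided; nothing on the blow-up TIME at criticality beyond
`T ≤ log(κ*/8)/ν`; no digit of `κ*` beyond the tree's `[19.76, 19.83]`; the located `19.7756ν` and the script-certified interval remain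
estimates / enclosures of `κ*ν` in their own tiers.
-/

noncomputable section

namespace Summit.NavierStokesRegularity.OSWSelfSimilar
namespace SheetNSLineTorusCascade

open Finset Real Set Filter MeasureTheory intervalIntegral Complex
open Literature.Analysis.Fourier
open scoped Topology

/-! ### Interior bounds of a classical solution -/

variable {ν c T : ℝ} {ω ωt ωx ωxx : ℝ → ℝ → ℝ}

/-- **The cascade right-hand side of a classical solution is uniformly bounded on every compact interior window**: for
`0 < ε`, `T′ < T` there is `Q` with `|½ Σ_{i+j=k} Re c_i Re c_j − νk² Re c_k| ≤ Q` for all `t ∈ [ε, T′]` and all `k`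
(the two expressions of `d/dt c_k`: the cascade, and `−(i/π)·(ωt)^(k)` with `|(ωt)^(k)| ≤ 2π sup|ωt|`). [new here — MODEL] -/
theorem exists_abs_rhs_le_interior (h : IsClassicalSolution ν T ω ωt ωx ωxx) (hω0 : ∀ x, ω 0 x = -c * Real.sin x)
    {ε T' : ℝ} (hε : 0 < ε) (hT' : T' < T) :
    ∃ Q : ℝ, ∀ t ∈ Icc ε T', ∀ k : ℕ,
      |(1 / 2) * (∑ p ∈ antidiagonal k, (coef ω p.1 t).re * (coef ω p.2 t).re)
        - ν * (k : ℝ) ^ 2 * (coef ω k t).re| ≤ Q := by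
  -- `ωt` is bounded on the compact `[ε, T'] × [0, 2π] ⊂ (0,T) × ℝ`
  have hK : IsCompact (Icc ε T' ×ˢ Icc (0 : ℝ) (2 * π)) := isCompact_Icc.prod isCompact_Icc
  have hsub : Icc ε T' ×ˢ Icc (0 : ℝ) (2 * π) ⊆ Ioo 0 T ×ˢ univ :=
    Set.prod_mono (fun t ht => ⟨lt_of_lt_of_le hε ht.1, lt_of_le_of_lt ht.2 hT'⟩) (Set.subset_univ _)
  obtain ⟨P, hP⟩ := hK.exists_bound_of_continuousOn (h.cont_t.mono hsub)
  refine ⟨‖-(I / (π : ℂ))‖ * (P * |2 * π - 0|), fun t ht k => ?_⟩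
  have htI : t ∈ Ioo (0 : ℝ) T := ⟨lt_of_lt_of_le hε ht.1, lt_of_le_of_lt ht.2 hT'⟩
  have htc : t ∈ Icc (0 : ℝ) T := Ioo_subset_Icc_self htI
  -- the two derivatives of `coef ω k` at `t`
  have h1 := hasDerivAt_coef h hω0 htI k
  have h2 : HasDerivAt (coef ω k) (-(I / π) * modeCoeff (2 * π) k (fun x => ((ωt t x : ℝ) : ℂ))) t := by
    have := (hasDerivAt_mode h htI k).const_mul (-(I / π))
    exact this
  have heq := h1.unique h2
  -- real part of the cascade right-hand side
  have hre : ((((1 / 2 : ℝ) : ℂ) * (∑ p ∈ antidiagonal k, coef ω p.1 t * coef ω p.2 t)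
        - ((ν * (k : ℝ) ^ 2 : ℝ) : ℂ) * coef ω k t)).re
      = (1 / 2) * (∑ p ∈ antidiagonal k, (coef ω p.1 t).re * (coef ω p.2 t).re)
        - ν * (k : ℝ) ^ 2 * (coef ω k t).re := by
    rw [Complex.sub_re, Complex.re_ofReal_mul, Complex.re_ofReal_mul, Complex.re_sum]
    congr 2
    refine sum_congr rfl fun p _ => ?_
    rw [Complex.mul_re, coef_im_eq_zero h hω0 p.1 t htc, coef_im_eq_zero h hω0 p.2 t htc]
    ring
  -- the mode of `ωt(t,·)` is bounded by `2π·sup|ωt|` (integration over `[0, 2π]` only)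
  have hmc : ‖modeCoeff (2 * π) (k : ℤ) (fun x => ((ωt t x : ℝ) : ℂ))‖ ≤ P * |2 * π - 0| := by
    unfold modeCoeff
    refine intervalIntegral.norm_integral_le_of_norm_le_const fun x hx => ?_
    rw [norm_mul, Complex.norm_real, Real.norm_eq_abs]
    have h1' : ‖fourier (-(k : ℤ)) (x : AddCircle (2 * π))‖ = 1 := by
      rw [fourier_coe_apply, show 2 * π * I * (-(k : ℤ) : ℤ) * x / (2 * π : ℝ)
          = (((2 * π * (-(k : ℤ) : ℤ) * x / (2 * π)) : ℝ) : ℂ) * I by push_cast; ring,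
        Complex.norm_exp_ofReal_mul_I]
    rw [h1', one_mul]
    rw [Set.uIoc_of_le (by positivity)] at hx
    have := hP (t, x) ⟨ht, Ioc_subset_Icc_self hx⟩
    simpa [Real.norm_eq_abs] using this
  rw [← hre, heq]
  calc |(-(I / π) * modeCoeff (2 * π) k (fun x => ((ωt t x : ℝ) : ℂ))).re|
      ≤ ‖-(I / π) * modeCoeff (2 * π) k (fun x => ((ωt t x : ℝ) : ℂ))‖ := Complex.abs_re_le_norm _
    _ = ‖-(I / (π : ℂ))‖ * ‖modeCoeff (2 * π) k (fun x => ((ωt t x : ℝ) : ℂ))‖ := norm_mul _ _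
    _ ≤ ‖-(I / (π : ℂ))‖ * (P * |2 * π - 0|) := by gcongr

/-- **A classical solution from the sine datum is WIENER-bounded on every compact sub-window.** For `ν > 0`, `c > 0`, a
classical solution on `[0, T]` from `−c sin x` and `T′ < T`: the Galerkin sums of the explicit sine cascade (= its cascade
variables) are bounded on `[0, T′]`, uniformly in `K`. [new here — MODEL] -/
theorem exists_partialSum_cascadeSolution_le (h : IsClassicalSolution ν T ω ωt ωx ωxx)
    (hω0 : ∀ x, ω 0 x = -c * Real.sin x) (hν : 0 < ν) (hc : 0 < c) {T' : ℝ} (hT' : T' < T) :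
    ∃ B : ℝ, ∀ K : ℕ, ∀ t ∈ Icc (0 : ℝ) T', ∑ k ∈ range (K + 1), cascadeSolution ν (sineDatum c) k t ≤ B := by
  rcases lt_or_ge T' 0 with hT'neg | hT'0
  · exact ⟨0, fun K t ht => absurd (ht.1.trans ht.2) (not_le.mpr hT'neg)⟩
  have hT : 0 < T := lt_of_le_of_lt hT'0 hT'
  set e := cascadeSolution ν (sineDatum c) with he_def
  have he : IsNonnegCascade ν e := (isSineCascade_cascadeSolution ν c).isNonnegCascade hc.le
  have he1 : 0 < e 1 0 := by
    have := (isSineCascade_cascadeSolution ν c).one_init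
    rw [he_def, this]; exact hc
  have hdata : ∀ K, ∑ k ∈ range (K + 1), e k 0 ≤ c := partialSum_cascadeSolution_sine_zero_le ν hc.le
  -- the two uniform bounds of the classical solution
  obtain ⟨A, hA⟩ := exists_abs_coef_re_le_uniform h
  obtain ⟨Q, hQ⟩ := exists_abs_rhs_le_interior h hω0 (ε := 1 / c) (by positivity) hT'
  have hA0 : 0 ≤ A := le_trans (abs_nonneg _) (hA 0 ⟨le_rfl, hT.le⟩ 0)
  set Q' : ℝ := max Q 0 with hQ'
  have hQ'0 : 0 ≤ Q' := le_max_right _ _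
  refine ⟨max (2 * c) (2 * ((Q' + 2 * ((Q' + A ^ 2) / ν) ^ 2) / ν)), fun K t ht => ?_⟩
  rcases le_or_gt t (1 / c) with htc | htc
  · -- short time: Riccati without size condition
    exact (he.partialSum_le_two_mul hν.le he1 hdata K ht.1 htc).trans (le_max_left _ _)
  · -- interior window `[1/c, T']`: bootstrap on the cascade right-hand side
    have htI : t ∈ Icc (1 / c) T' := ⟨htc.le, ht.2⟩
    have htT : t ∈ Icc (0 : ℝ) T := ⟨ht.1, ht.2.trans hT'.le⟩
    have hce : ∀ k : ℕ, (coef ω k t).re = e k t := fun k => coef_re_eq_cascadeSolution h hω0 hT k htT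
    refine le_trans ?_ (le_max_right _ _)
    refine partialSum_le_of_rhs_bound (a := fun k => e k t) hν hQ'0 hA0 (he.zero t)
      (fun k => he.nonneg k t ht.1) (fun k => ?_) (fun k _ => ?_) K
    · have := hA t htT k
      rw [hce k] at this
      exact (le_abs_self _).trans this
    · have hq := hQ t htI k
      simp only [hce] at hq
      have hq' := (abs_le.mp hq).1
      have hQQ : Q ≤ Q' := le_max_left _ _
      linarith

/-- **Transfer to the universal family**: a Galerkin bound `B` for the explicit sine cascade (`ν`, `c`) on `[0, T₀]` is the
Galerkin bound `B/ν` for the amplitude-`c/ν` universal family on `[0, νT₀]` (`c_k(t) = ν (c/ν)^k E_k(νt)`). [new here — MODEL] -/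
theorem universal_partialSum_le_of_sine (hν : 0 < ν) {T₀ B : ℝ}
    (hB : ∀ K : ℕ, ∀ t ∈ Icc (0 : ℝ) T₀, ∑ k ∈ range (K + 1), cascadeSolution ν (sineDatum c) k t ≤ B) :
    ∀ K : ℕ, ∀ τ ∈ Icc (0 : ℝ) (ν * T₀),
      ∑ k ∈ range (K + 1), (c / ν) ^ k * cascadeSolution 1 (sineDatum 1) k τ ≤ B / ν := by
  intro K τ hτ
  have ht : τ / ν ∈ Icc (0 : ℝ) T₀ :=
    ⟨div_nonneg hτ.1 hν.le, by rw [div_le_iff₀ hν]; linarith [hτ.2, mul_comm ν T₀]⟩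
  have h1 := hB K (τ / ν) ht
  have hντ : ν * (τ / ν) = τ := by field_simp
  rw [le_div_iff₀ hν, sum_mul]
  refine le_of_eq_of_le ?_ h1
  refine sum_congr rfl fun k _ => ?_
  rw [cascadeSolution_sine_eq_universal hν c k (τ / ν) ht.1, hντ]
  ring

/-! ### The theorems -/

/-- **THE STRICT HORIZON LEMMA.** For `ν > 0`, `c ≥ 0`: if a classical `2π`-periodic solution of the MODEL PDE from `−c sin x` exists
on `[0, T]` with **`T > log(c/(8ν))/ν`**, then **`c < κ*ν`**. (g14 had the non-strict form `c ≤ κ*ν`; the gain is the Wiener bound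
of a classical solution on compact sub-windows and the openness of the window-Wiener set.) [new here — MODEL] -/
theorem lt_critical_of_horizon_gt (h : IsClassicalSolution ν T ω ωt ωx ωxx) (hω0 : ∀ x, ω 0 x = -c * Real.sin x)
    (hν : 0 < ν) (hc : 0 ≤ c) (hT : Real.log (c / (8 * ν)) / ν < T) : c < criticalConstant * ν := by
  -- trivial when `c < 8ν`
  rcases lt_or_ge c (8 * ν) with hc8 | hc8
  · exact lt_trans hc8 (by nlinarith [eight_lt_criticalConstant])
  have hcpos : 0 < c := lt_of_lt_of_le (by positivity) hc8
  -- pick `T'` strictly between `log(c/(8ν))/ν` and `T`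
  obtain ⟨T', hT'1, hT'2⟩ := exists_between hT
  obtain ⟨B, hB⟩ := exists_partialSum_cascadeSolution_le h hω0 hν hcpos hT'2
  -- transfer to the universal family on `[0, ν T']`
  have hU := universal_partialSum_le_of_sine (c := c) hν hB
  have hL : Real.log (c / ν / 8) < ν * T' := by
    rw [div_div, mul_comm ν 8]
    have := hT'1
    rw [div_lt_iff₀ hν] at this
    linarith [mul_comm T' ν]
  have := lt_criticalConstant_of_partialSum_le (div_nonneg hc hν.le) hU hL
  rwa [div_lt_iff₀ hν] at this

/-- **Contrapositive: `κ*ν ≤ c` ⇒ every classical solution from `−c sin x` has `T ≤ log(c/(8ν))/ν`.** [new here — MODEL] -/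
theorem horizon_le_of_critical_le (h : IsClassicalSolution ν T ω ωt ωx ωxx) (hω0 : ∀ x, ω 0 x = -c * Real.sin x)
    (hν : 0 < ν) (hle : criticalConstant * ν ≤ c) : T ≤ Real.log (c / (8 * ν)) / ν := by
  by_contra hcon
  have hc : 0 ≤ c := le_trans (mul_pos criticalConstant_pos hν).le hle
  exact absurd (lt_critical_of_horizon_gt h hω0 hν hc (not_le.mp hcon)) (not_lt.mpr hle)

/-- **AT THE CRITICAL AMPLITUDE `c = κ*ν`: every classical solution from `−κ*ν sin x` has `T ≤ log(κ*/8)/ν`** (while one exists on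
`[0, T₀]` for every `T₀ < 2/(κ*ν)`: eng-3's `exists_local_classicalSolution`). [new here — MODEL] -/
theorem horizon_le_critical (h : IsClassicalSolution ν T ω ωt ωx ωxx)
    (hω0 : ∀ x, ω 0 x = -(criticalConstant * ν) * Real.sin x) (hν : 0 < ν) :
    T ≤ Real.log (criticalConstant / 8) / ν := by
  have := horizon_le_of_critical_le h hω0 hν le_rfl
  rwa [mul_div_mul_right _ _ hν.ne'] at this

/-- **No global classical solution at or above the critical amplitude** (`c ≥ κ*ν`). [new here — MODEL] -/
theorem not_global_of_critical_le (hν : 0 < ν) (hle : criticalConstant * ν ≤ c) :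
    ¬ ∃ ω ωt ωx ωxx : ℝ → ℝ → ℝ, (∀ x, ω 0 x = -c * Real.sin x) ∧ ∀ T : ℝ, IsClassicalSolution ν T ω ωt ωx ωxx := by
  rintro ⟨ω, ωt, ωx, ωxx, hω0, hall⟩
  have := horizon_le_of_critical_le (hall (Real.log (c / (8 * ν)) / ν + 1)) hω0 hν hle
  linarith

/-- **THE CRITICAL AMPLITUDE IS NOT GLOBAL**: there is no global classical solution from `−κ*ν sin x` (`ν > 0`). [new here — MODEL] -/
theorem not_global_critical (hν : 0 < ν) :
    ¬ ∃ ω ωt ωx ωxx : ℝ → ℝ → ℝ, (∀ x, ω 0 x = -(criticalConstant * ν) * Real.sin x) ∧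
      ∀ T : ℝ, IsClassicalSolution ν T ω ωt ωx ωxx :=
  not_global_of_critical_le hν le_rfl

/-- **GLOBAL IFF BELOW THE CRITICAL CONSTANT — for EVERY `c ≥ 0`** (no exception at `c = κ*ν`): for `ν > 0` a global classical
solution from `−c sin x` exists iff `c < κ*ν`. [new here — MODEL] -/
theorem global_iff_lt_critical_all (hν : 0 < ν) (hc : 0 ≤ c) :
    (∃ ω ωt ωx ωxx : ℝ → ℝ → ℝ, (∀ x, ω 0 x = -c * Real.sin x) ∧ ∀ T : ℝ, IsClassicalSolution ν T ω ωt ωx ωxx) ↔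
      c < criticalConstant * ν := by
  refine ⟨fun hex => ?_, exists_global_classicalSolution_of_lt_critical hν hc⟩
  by_contra hcon
  exact not_global_of_critical_le hν (not_lt.mp hcon) hex

/-! ### The Wiener continuation criterion (converse direction) -/

/-- **WIENER CONTINUATION CRITERION.** For `ν > 0`, `c > 0`, `T₀ > 0`: if the Galerkin sums of the explicit sine cascade are bounded on
`[0, T₀]`, a classical solution from `−c sin x` EXISTS on `[0, T₀]` (openness gives a Galerkin bound at a larger amplitude on the
same window, i.e. a geometric envelope `A·k·q^k` on `[0, T₀]`; then eng-3's `exists_classicalSolution_of_window_envelope`). With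
`exists_partialSum_cascadeSolution_le`: the classical solution lives exactly as long as its Wiener norm stays bounded. [new here — MODEL] -/
theorem exists_classicalSolution_of_partialSum_le (hν : 0 < ν) (hc : 0 < c) {T₀ B : ℝ} (hT₀ : 0 < T₀)
    (hB : ∀ K : ℕ, ∀ t ∈ Icc (0 : ℝ) T₀, ∑ k ∈ range (K + 1), cascadeSolution ν (sineDatum c) k t ≤ B) :
    ∃ ω ωt ωx ωxx : ℝ → ℝ → ℝ, (∀ x, ω 0 x = -c * Real.sin x) ∧ IsClassicalSolution ν T₀ ω ωt ωx ωxx := by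
  have hκ : 0 < c / ν := div_pos hc hν
  set L : ℝ := ν * T₀ with hLdef
  -- a positive Galerkin bound for the universal family on `[0, L]`
  set B' : ℝ := max (B / ν) 1 with hB'def
  have hB'0 : 0 < B' := lt_of_lt_of_le one_pos (le_max_right _ _)
  have hU : ∀ K : ℕ, ∀ τ ∈ Icc (0 : ℝ) L,
      ∑ k ∈ range (K + 1), (c / ν) ^ k * cascadeSolution 1 (sineDatum 1) k τ ≤ B' :=
    fun K τ hτ => (universal_partialSum_le_of_sine (c := c) hν hB K τ hτ).trans (le_max_left _ _)
  -- openness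
  set δ : ℝ := B' / Real.exp (B' * L) with hδdef
  have hδ : 0 < δ := div_pos hB'0 (exp_pos _)
  have hsmall : δ * (Real.exp (B' * L) - 1) ≤ B' := by
    have hE : 0 < Real.exp (B' * L) := exp_pos _
    calc δ * (Real.exp (B' * L) - 1) ≤ δ * Real.exp (B' * L) := mul_le_mul_of_nonneg_left (by linarith) hδ.le
      _ = B' := div_mul_cancel₀ B' hE.ne'
  have hgal := partialSum_le_of_partialSum_le hκ hδ hU hsmall
  set B'' : ℝ := B' + 2 * δ * Real.exp (B' * L) with hB''def
  have hB''0 : 0 ≤ B'' := by positivity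
  -- the geometric window envelope at ratio `q = (c/ν)/((c/ν) + δ)`
  set q : ℝ := (c / ν) / (c / ν + δ) with hqdef
  have hq0 : 0 < q := by positivity
  have hq1 : q < 1 := (div_lt_one (by positivity)).mpr (by linarith)
  have hbw : ∀ k : ℕ, ∀ t ∈ Icc (0 : ℝ) T₀, |cascadeSolution ν (sineDatum c) k t| ≤ ν * B'' * k * q ^ k := by
    intro k t ht
    have hs := isSineCascade_cascadeSolution ν c
    rw [abs_of_nonneg (nonneg hs hc.le k t ht.1)]
    rcases Nat.eq_zero_or_pos k with hk | hk
    · subst hk; rw [hs.zero t]; simp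
    have hk1 : (1 : ℝ) ≤ k := by exact_mod_cast hk
    have hτ : ν * t ∈ Icc (0 : ℝ) L := ⟨mul_nonneg hν.le ht.1, mul_le_mul_of_nonneg_left ht.2 hν.le⟩
    have hterm := smul_universal_le_of_partialSum_le (κ := c / ν + δ) (by positivity) (s := Icc 0 L)
      (fun x hx => hx.1) hgal k hτ
    rw [cascadeSolution_sine_eq_universal hν c k t ht.1]
    have hqκ : q * (c / ν + δ) = c / ν := by rw [hqdef]; field_simp
    have hpow : (c / ν) ^ k = q ^ k * (c / ν + δ) ^ k := by rw [← mul_pow, hqκ]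
    have hid : ν * (c / ν) ^ k * cascadeSolution 1 (sineDatum 1) k (ν * t)
        = ν * q ^ k * ((c / ν + δ) ^ k * cascadeSolution 1 (sineDatum 1) k (ν * t)) := by
      rw [hpow]; ring
    rw [hid]
    calc ν * q ^ k * ((c / ν + δ) ^ k * cascadeSolution 1 (sineDatum 1) k (ν * t))
        ≤ ν * q ^ k * B'' := mul_le_mul_of_nonneg_left hterm (by positivity)
      _ = ν * B'' * 1 * q ^ k := by ring
      _ ≤ ν * B'' * k * q ^ k := by gcongr
  exact exists_classicalSolution_of_window_envelope (isSineCascade_cascadeSolution ν c) hT₀ (by positivity) hq0.le hq1 hbw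

/-! ### One citation -/

/-- **THE SHARP-THRESHOLD THEOREM FOR THE SINE DATUM, CRITICAL CASE INCLUDED (one citation).** There is ONE constant
`κ* = criticalConstant` of the MODEL, `494/25 ≤ κ* ≤ 1983/100`, such that for every `ν > 0` and `c ≥ 0`: the MODEL PDE
`ω_t = ω·Hω + ν ω_xx` on `𝕋` has a GLOBAL classical `2π`-periodic solution from `ω(0,·) = −c sin` **iff `c < κ*ν`**, and for `c ≥ κ*ν`
every classical solution from that datum has horizon `T ≤ log(c/(8ν))/ν` (strictly `<` for `c > κ*ν`: g14's `horizon_lt_of_critical_lt`).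
[new here — MODEL] -/
theorem sine_datum_sharp_dichotomy {ν c : ℝ} (hν : 0 < ν) (hc : 0 ≤ c) :
    ((494 / 25 : ℝ) ≤ criticalConstant ∧ criticalConstant ≤ 1983 / 100) ∧
    ((∃ ω ωt ωx ωxx : ℝ → ℝ → ℝ, (∀ x, ω 0 x = -c * Real.sin x) ∧ ∀ T : ℝ, IsClassicalSolution ν T ω ωt ωx ωxx) ↔
      c < criticalConstant * ν) ∧
    (criticalConstant * ν ≤ c → ∀ {T : ℝ} {ω ωt ωx ωxx : ℝ → ℝ → ℝ}, IsClassicalSolution ν T ω ωt ωx ωxx →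
      (∀ x, ω 0 x = -c * Real.sin x) → T ≤ Real.log (c / (8 * ν)) / ν) :=
  ⟨⟨le_criticalConstant, criticalConstant_le⟩, global_iff_lt_critical_all hν hc,
    fun hle _ _ _ _ _ h hω0 => horizon_le_of_critical_le h hω0 hν hle⟩

end SheetNSLineTorusCascade
end Summit.NavierStokesRegularity.OSWSelfSimilar
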